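import Literature.NumberTheory.GaloisRepresentations.IdeleBarKSMaps
import Literature.NumberTheory.GaloisRepresentations.IdeleTruncationUnits
import Literature.NumberTheory.GaloisRepresentations.IdeleProjectionS
import Literature.NumberTheory.GaloisRepresentations.IdeleClassBarS
import Literature.NumberTheory.GaloisRepresentations.SUnitsValuation
import Literature.NumberTheory.GaloisRepresentations.SUnitsIdeleBridge
import Literature.NumberTheory.GaloisRepresentations.GalLayerSystemUnitsBar
import Literature.Algebra.Homology.DiscreteRepContinuous
import HarnessLib

/-!
# Harari's sequence `0 → E_S → I_S → C_S → 0` (17.1) in `C_{G_S}`, I: the `S`-UNITS `E_S = 𝒪_{K_S,S}ˣ`, the maps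
# `E_S → I_S → C̄_S`, the short complex, injectivity of `E_S → I_S` (Harari §17.4; NSW VIII §3)

Topic `NumberTheory/GaloisRepresentations`; namespace `Literature.NumberTheory.GaloisRepresentations.IdeleClassBar` (plus a
generic lemma in `….GalLayerData`).  Sequel to `IdeleBarKSMaps.lean` (`unitsBarKS K S = K_Sˣ`, `unitsToTruncKS`,
`truncIdeleBarToClassKS`), `IdeleTruncationUnits.lean` (`unitsToTruncKS_injective`), `IdeleProjectionS.lean`
(`truncIdeleBarD K S = I_S ∈ C_{G_S}`), `IdeleClassBarS.lean` (-w3 g17: `classBarSD K S = C̄_S`, `toClassBarS`, `ofLayerS`),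
`SUnitsGaloisModule.lean` / `SUnitsValuation.lean` (`SUnits.sUnitsRestricted K S = 𝒪_{K_S,S}ˣ` as a continuous
`G_S`-module; `S`-units by valuations) and `GalLayerSystemUnitsBar.lean` (`unitsBarAddEquiv : lim→ Eˣ ≃+ K̄ˣ`).
Definitions with bodies and theorems; NO named fact, no `sorry`, no instance, no notation; number fields in `Type`.

THE POINT (cell bsd-eis, lane «PT-Ш-S-TC», brick D3/D4b step F2e; FINDING of -w6 g11, 2026-08-29).  The first term of
Harari's exact sequence (17.1) `0 → E_S → I_S → C_S → 0` of discrete `G_S`-modules is the group of `S`-UNITS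
`E_S = lim→_{F ⊂ K_S} 𝒪_{F,S}ˣ` (Harari §17.4 p. 296), NOT the full multiplicative group `K_Sˣ = (lim→ Eˣ)^{N_S}`
(`unitsBarKS K S`): for `a ∈ K_Sˣ` which is not an `S`-unit the class of the truncated principal idèle `(a)^{(S)}` in
`C_S(F) = I_F/Fˣ U_{F,S}` is NOT trivial (its components off `S` are those of `((a)^{off S})⁻¹`, and `c ∈ Fˣ` with
`(a)^{(S)} = (c) u`, `u ∈ U_{F,S}`, is an `S`-unit equal to `a` at an archimedean place).  This file builds the
sequence with the correct first term:
* §1 (generic) `GalLayerData.exists_layer_le_of_forall_rep_eq`: an element of `lim→ D_E` fixed by a normal subgroup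
  `N ≤ Γ_K` comes from a layer `E` with `N ≤ U_E`.
* §2 **`sUnitsKSD K S : C_{G_S}`** `:= ofContinuousRep (SUnits.sUnitsRestricted K ↑S)` — `E_S` as an object of door-c4's
  category; `sUnitsToUnitsKS : E_S →+ K_Sˣ = unitsBarKS K S` (through `unitsBarAddEquiv⁻¹`), injective and
  `G_S`-equivariant; every element of `E_S` is `[a]_E` for an `S`-unit `a` of a layer `E ⊂ K_S` (`exists_layer_sUnit`).
* §3 **`sUnitsToTruncD K S : sUnitsKSD K S ⟶ truncIdeleBarD K S`** (`E_S → I_S`, `a ↦ [(a)^{(S)}]`: principal idèle,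
  truncated; = `unitsToTruncKS ∘ sUnitsToUnitsKS`), its formula on layers, and **injectivity** (`unitsToTruncKS_injective`).
* §4 **`truncToClassBarSD K S : truncIdeleBarD K S ⟶ classBarSD K S`** (`I_S → C̄_S`, = `truncIdeleBarToClassKS ≫ toClassBarS`),
  its formula on layers `[x]_E ↦ ofLayerS [x]`.
* §5 `(a) ∈ J_{E,S}^{Tate}` iff `a` is an `S`-unit; for an `S`-unit `(a) = (a)^{(S)} · u` with `u ∈ U_{E,S}`, so the class of
  `(a)^{(S)}` is that of `u⁻¹` and DIES in `C̄_S`: **`truncToClassBarSD_sUnitsToTruncD : f ≫ g = 0`**; the short complex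
  **`truncSeqS K S : ShortComplex (DiscreteRepCat ℤ G_S)`** (= (17.1)); `mono_truncSeqS_f`.
Exactness in the middle and surjectivity of `I_S → C̄_S` (the latter only in the limit over `K_S`, by capitulation of
`Cl_{F,S}` in the Hilbert class field, Harari Lemma 15.39) are the sequel `IdeleTruncatedSUnitsSequenceExact.lean`.

HONEST FRAMING: bookkeeping of classical objects; no duality theorem and no case of BSD is proved here.

## References
* D. Harari, *Galois Cohomology and Class Field Theory*, Universitext, Springer (2020), Def. 15.38, Lemma 15.39, §17.4
  (p. 296) and (17.1). [Harari2020]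
* J. Neukirch, A. Schmidt, K. Wingberg, *Cohomology of Number Fields*, 2nd ed. (2008), VIII §3 (`E_S = 𝒪_{k_S,S}^×`),
  (8.3.8)–(8.3.9). [NeukirchSchmidtWingberg2008]
* J. S. Milne, *Arithmetic Duality Theorems*, 2nd ed. (2006), I §4 (p. 55). [MilneADT2006]
-/

noncomputable section

open NumberField IsDedekindDomain CategoryTheory
open Field (absoluteGaloisGroup)
open Literature.NumberTheory.Automorphic Literature.Algebra.Homology
open Literature.NumberTheory.GaloisRepresentations.LocalWeilDatum (galFixing)
open scoped Classical

namespace Literature.NumberTheory.GaloisRepresentations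

/-! ## §1. Generic: an `N`-invariant element of `lim→ D_E` comes from a layer `E` with `N ≤ U_E` -/

namespace GalLayerData

open IdeleClassBar

variable {K : Type} [Field K] [NumberField K] (D : GalLayerData K)

/-- **An element of `lim→_E D_E` fixed by a normal subgroup `N ≤ Γ_K` comes from a layer `E` with `N ≤ U_E`**
(`z = [y]_M` is fixed by the open normal subgroup `U_M ⊔ N`, whose layer carries `z` by Galois descent).
[cite: CasselsFrohlichANT1967, Ch. VII §8 Prop. 8.1] [cite: Harari2020, §17.4 (17.1)] -/
theorem exists_layer_le_of_forall_rep_eq (N : Subgroup (absoluteGaloisGroup K)) [N.Normal] (z : D.toSystem.limit)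
    (hz : ∀ σ ∈ N, D.toSystem.rep σ z = z) :
    ∃ (E : GalLayer K), N ≤ (E.openNormalSubgroup : Subgroup (absoluteGaloisGroup K)) ∧
      ∃ x : D.V E, D.toSystem.of E x = z := by
  obtain ⟨M, y, rfl⟩ := D.toSystem.exists_of z
  let W : OpenNormalSubgroup (absoluteGaloisGroup K) :=
    { toSubgroup := (M.openNormalSubgroup : Subgroup (absoluteGaloisGroup K)) ⊔ N
      isOpen' := Subgroup.isOpen_mono (le_sup_left (a := (M.openNormalSubgroup : Subgroup (absoluteGaloisGroup K))))
        M.openNormalSubgroup.toOpenSubgroup.isOpen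
      isNormal' := Subgroup.sup_normal _ _ }
  have hW : (W : Subgroup (absoluteGaloisGroup K)) = (M.openNormalSubgroup : Subgroup (absoluteGaloisGroup K)) ⊔ N := rfl
  refine ⟨GalLayer.ofOpenNormalSubgroup W, ?_, ?_⟩
  · rw [GalLayer.openNormalSubgroup_ofOpenNormalSubgroup, hW]
    exact le_sup_right
  · refine D.toSystem.exists_of_eq_of_forall_mem _ _ fun σ hσ => ?_
    have hσ' : σ ∈ ((GalLayer.ofOpenNormalSubgroup W).openNormalSubgroup : Subgroup (absoluteGaloisGroup K)) := hσ
    rw [GalLayer.openNormalSubgroup_ofOpenNormalSubgroup, hW] at hσ'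
    have hle : (M.openNormalSubgroup : Subgroup (absoluteGaloisGroup K)) ⊔ N ≤
        DiscreteRep.stabilizer D.toSystem.toRep (D.toSystem.of M y) :=
      sup_le (D.toSystem.openNormalSubgroup_le_stabilizer_of M y) fun τ hτ => hz τ hτ
    exact hle hσ'

end GalLayerData

namespace IdeleClassBar

open IdeleCohomology SUnits DiscreteGaloisModule

variable (K : Type) [Field K] [NumberField K] (S : Finset (HeightOneSpectrum (𝓞 K)))

/-! ## §2. `E_S = 𝒪_{K_S,S}ˣ` as an object of `C_{G_S}`, and its embedding into `K_Sˣ` -/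

/-- **`E_S = 𝒪_{K_S,S}ˣ ∈ C_{G_S}`**: the `N_S`-invariants of the `S`-units of `K̄` with the induced continuous action of
`G_S = Γ_K ⧸ N_S` (the tree's `SUnits.sUnitsRestricted`), as an object of door-c4's `DiscreteRepCat ℤ G_S`.
[cite: Harari2020, §17.4 (p. 296)] [cite: NeukirchSchmidtWingberg2008, VIII §3] -/
abbrev sUnitsKSD : DiscreteRepCat ℤ (GaloisGroupUnramifiedOutside K (↑S : Set (HeightOneSpectrum (𝓞 K)))) :=
  DiscreteRep.ofContinuousRep (sUnitsRestricted K (↑S : Set (HeightOneSpectrum (𝓞 K))))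

variable {K S}

/-- An element of `E_S` is fixed by `N_S` inside `K̄ˣ`. [cite: NeukirchSchmidtWingberg2008, VIII §3] -/
theorem units_apply_sUnitsKS_of_mem (w : (sUnitsKSD K S).obj.V) {σ : absoluteGaloisGroup K}
    (hσ : σ ∈ ramificationSubgroup K (↑S : Set (HeightOneSpectrum (𝓞 K)))) :
    units K σ ((w.1 : sUnitsSubmodule K (↑S : Set (HeightOneSpectrum (𝓞 K)))) : UnitsCarrier K) =
      ((w.1 : sUnitsSubmodule K (↑S : Set (HeightOneSpectrum (𝓞 K)))) : UnitsCarrier K) :=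
  congrArg Subtype.val (w.2 ⟨σ, hσ⟩)

/-- Membership in `K_Sˣ = (lim→ Eˣ)^{N_S}`: fixed by `N_S`. [cite: Harari2020, §17.4] -/
theorem mem_unitsInvariantsKS_iff_forall (z : (unitsData K).toSystem.limit) :
    z ∈ Representation.invariants ((unitsData K).toSystem.toRep.ρ.comp
        (ramificationSubgroup K (↑S : Set (HeightOneSpectrum (𝓞 K)))).subtype) ↔
      ∀ σ ∈ ramificationSubgroup K (↑S : Set (HeightOneSpectrum (𝓞 K))), (unitsData K).toSystem.rep σ z = z := by
  rw [Representation.mem_invariants]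
  exact ⟨fun h σ hσ => h ⟨σ, hσ⟩, fun h g => h g.1 g.2⟩

variable (K S) in
/-- **`E_S → K_Sˣ = (lim→ Eˣ)^{N_S}`** on vectors: `u ↦ unitsBarAddEquiv⁻¹ u` (the tree's identification
`lim→_E Eˣ ≃+ K̄ˣ`, restricted to `N_S`-invariants). [cite: Harari2020, §17.4 (p. 296)] -/
def sUnitsToUnitsKS : (sUnitsKSD K S).obj.V →+ (unitsBarKS K S).V :=
  AddMonoidHom.mk'
    (fun w => ⟨(unitsBarAddEquiv K).symm ((w.1 : sUnitsSubmodule K (↑S : Set (HeightOneSpectrum (𝓞 K)))) : UnitsCarrier K),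
      (mem_unitsInvariantsKS_iff_forall _).2 fun σ hσ => by
        apply (unitsBarAddEquiv K).injective
        rw [unitsBarAddEquiv_rep, AddEquiv.apply_symm_apply]
        exact units_apply_sUnitsKS_of_mem w hσ⟩)
    fun w w' => Subtype.ext (by
      change (unitsBarAddEquiv K).symm (((w + w').1 : sUnitsSubmodule K (↑S : Set (HeightOneSpectrum (𝓞 K)))) :
          UnitsCarrier K) = (unitsBarAddEquiv K).symm _ + (unitsBarAddEquiv K).symm _
      rw [← map_add]
      rfl)

/-- Formula. [cite: Harari2020, §17.4 (p. 296)] -/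
@[simp] theorem coe_sUnitsToUnitsKS_apply (w : (sUnitsKSD K S).obj.V) :
    ((sUnitsToUnitsKS K S w).1 : (unitsData K).toSystem.limit) =
      (unitsBarAddEquiv K).symm ((w.1 : sUnitsSubmodule K (↑S : Set (HeightOneSpectrum (𝓞 K)))) : UnitsCarrier K) := rfl

/-- `E_S → K_Sˣ` is injective. [cite: Harari2020, §17.4 (p. 296)] -/
theorem sUnitsToUnitsKS_injective : Function.Injective (sUnitsToUnitsKS K S) := fun w w' h => by
  have h1 : (unitsBarAddEquiv K).symm ((w.1 : sUnitsSubmodule K (↑S : Set (HeightOneSpectrum (𝓞 K)))) : UnitsCarrier K) =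
      (unitsBarAddEquiv K).symm ((w'.1 : sUnitsSubmodule K (↑S : Set (HeightOneSpectrum (𝓞 K)))) : UnitsCarrier K) :=
    congrArg Subtype.val h
  exact Subtype.ext (Subtype.ext ((unitsBarAddEquiv K).symm.injective h1))

/-- **`E_S → K_Sˣ` is `G_S`-equivariant.** [cite: Harari2020, §17.4 (p. 296)] -/
theorem sUnitsToUnitsKS_ρ (σ : absoluteGaloisGroup K) (w : (sUnitsKSD K S).obj.V) :
    sUnitsToUnitsKS K S ((sUnitsKSD K S).obj.ρ (QuotientGroup.mk σ) w) =
      (unitsBarKS K S).ρ (QuotientGroup.mk σ) (sUnitsToUnitsKS K S w) := by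
  apply Subtype.ext
  change (unitsBarAddEquiv K).symm (units K σ ((w.1 : sUnitsSubmodule K (↑S : Set (HeightOneSpectrum (𝓞 K)))) :
      UnitsCarrier K)) = (unitsData K).toSystem.rep σ ((unitsBarAddEquiv K).symm _)
  apply (unitsBarAddEquiv K).injective
  rw [AddEquiv.apply_symm_apply, unitsBarAddEquiv_rep, AddEquiv.apply_symm_apply]

/-- **Every element of `E_S` is `[a]_E` for an `S`-unit `a` of a layer `E ⊂ K_S`.** [cite: Harari2020, §17.4 (p. 296)]
[cite: NeukirchSchmidtWingberg2008, VIII §3 (`E_S = lim→ 𝒪_{K,S}^×`)] -/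
theorem exists_layer_sUnit (w : (sUnitsKSD K S).obj.V) :
    ∃ (E : GalLayer K) (_ : ramificationSubgroup K (↑S : Set (HeightOneSpectrum (𝓞 K))) ≤
        (E.openNormalSubgroup : Subgroup (absoluteGaloisGroup K))) (a : (E.1)ˣ),
      a ∈ sUnits K (↑S : Set (HeightOneSpectrum (𝓞 K))) E.1 ∧
        (unitsData K).toSystem.of E (Additive.ofMul a) = (sUnitsToUnitsKS K S w).1 := by
  obtain ⟨E, hE, x, hx⟩ := (unitsData K).exists_layer_le_of_forall_rep_eq
    (ramificationSubgroup K (↑S : Set (HeightOneSpectrum (𝓞 K)))) (sUnitsToUnitsKS K S w).1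
    ((mem_unitsInvariantsKS_iff_forall _).1 (sUnitsToUnitsKS K S w).2)
  refine ⟨E, hE, Additive.toMul x, ?_, hx⟩
  -- `a` is an `S`-unit since its image in `K̄ˣ` is `w`
  have hw := (mem_sUnitsSubmodule_iff K (↑S : Set (HeightOneSpectrum (𝓞 K))) _).1
    (w.1 : sUnitsSubmodule K (↑S : Set (HeightOneSpectrum (𝓞 K)))).2
  have hval : UnitsCarrier.toAdditive ((w.1 : sUnitsSubmodule K (↑S : Set (HeightOneSpectrum (𝓞 K)))) : UnitsCarrier K) =
      unitsBarToUnits K ((unitsData K).toSystem.of E x) := by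
    rw [hx, coe_sUnitsToUnitsKS_apply, ← toAdditive_unitsBarAddEquiv, AddEquiv.apply_symm_apply]
  rw [hval, unitsBarToUnits_of] at hw
  have hw' : Units.map (E.1.val : E.1 →* AlgebraicClosure K) (Additive.toMul x) ∈
      sUnits K (↑S : Set (HeightOneSpectrum (𝓞 K))) (AlgebraicClosure K) := hw
  exact (map_mem_sUnits_iff (K := K) (S := (↑S : Set (HeightOneSpectrum (𝓞 K)))) E.1.val (Additive.toMul x)).1 hw'

/-! ## §3. `E_S → I_S`: the truncated principal idèle of an `S`-unit -/

variable (K S) in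
/-- `E_S → I_S` on vectors: `u ↦ [(a)^{(S)}]` (`unitsToTruncKS` after `E_S → K_Sˣ`). [cite: Harari2020, §17.4 (17.1), Lemma 15.39 (the map `i`)] -/
def sUnitsToTruncAddHom : (sUnitsKSD K S).obj.V →+ (truncIdeleBarD K S).obj.V :=
  AddMonoidHom.mk' (fun w => (unitsToTruncKS K S).hom (sUnitsToUnitsKS K S w)) fun _ _ => by
    rw [map_add, map_add]

/-- Formula. [cite: Harari2020, §17.4 (17.1)] -/
theorem sUnitsToTruncAddHom_apply (w : (sUnitsKSD K S).obj.V) :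
    sUnitsToTruncAddHom K S w = (unitsToTruncKS K S).hom (sUnitsToUnitsKS K S w) := rfl

/-- The underlying element of `J̄`: `trunc` of the limit principal idèle. [cite: Harari2020, §17.4 (17.1)] -/
theorem coe_sUnitsToTruncAddHom_apply (w : (sUnitsKSD K S).obj.V) :
    Subtype.val (sUnitsToTruncAddHom K S w) =
      truncBar K S ((unitsToIdele K).limitMap ((unitsBarAddEquiv K).symm
        ((w.1 : sUnitsSubmodule K (↑S : Set (HeightOneSpectrum (𝓞 K)))) : UnitsCarrier K))) := rfl

variable (K S) in
/-- **`E_S → I_S` in `C_{G_S}`** (the first map of Harari's (17.1)). [cite: Harari2020, §17.4 (17.1)]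
[cite: NeukirchSchmidtWingberg2008, VIII §3] -/
def sUnitsToTruncD : sUnitsKSD K S ⟶ truncIdeleBarD K S :=
  letI : Module ℤ (sUnitsKSD K S).obj.V := (sUnitsKSD K S).obj.hV2
  ObjectProperty.homMk (Rep.ofHom
    ⟨{ toFun := sUnitsToTruncAddHom K S
       map_add' := fun w w' => map_add _ w w'
       map_smul' := fun c w => by
         have h := map_intCast_smul (sUnitsToTruncAddHom K S) ℤ ℤ c w
         rw [RingHom.id_apply]
         exact h },
      fun γ => LinearMap.ext fun w => by
        induction γ using QuotientGroup.induction_on with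
        | H σ =>
          change sUnitsToTruncAddHom K S ((sUnitsKSD K S).obj.ρ (QuotientGroup.mk σ) w) =
            (truncIdeleBarRep K S).ρ (QuotientGroup.mk σ) (sUnitsToTruncAddHom K S w)
          rw [sUnitsToTruncAddHom_apply, sUnitsToTruncAddHom_apply, sUnitsToUnitsKS_ρ]
          exact Rep.hom_comm_apply (unitsToTruncKS K S) (QuotientGroup.mk σ) _⟩)

/-- Formula: `sUnitsToTruncD` is `sUnitsToTruncAddHom` on vectors. [cite: Harari2020, §17.4 (17.1)] -/
theorem sUnitsToTruncD_hom_apply (w : (sUnitsKSD K S).obj.V) :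
    (sUnitsToTruncD K S).hom.hom w = sUnitsToTruncAddHom K S w := rfl

/-- **`E_S → I_S` is injective** (left exactness of (17.1); `unitsToTruncKS_injective` on `K_Sˣ`).
[cite: Harari2020, Lemma 15.39 (proof), §17.4 (17.1)] -/
theorem sUnitsToTruncD_injective : Function.Injective (sUnitsToTruncD K S).hom.hom := fun _ _ h =>
  sUnitsToUnitsKS_injective (unitsToTruncKS_injective K S h)

/-- **On a layer: `E_S → I_S` sends `[a]_E` (`a` an `S`-unit of `E ⊂ K_S`) to `[(a)^{(S)}]_E`.**
[cite: Harari2020, Lemma 15.39 (the map `i : a ↦ (a, …, a, 1, 1, …)`), §17.4 (17.1)] -/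
theorem coe_sUnitsToTruncD_of {w : (sUnitsKSD K S).obj.V} {E : GalLayer K} (a : (E.1)ˣ)
    (ha : (unitsData K).toSystem.of E (Additive.ofMul a) = (sUnitsToUnitsKS K S w).1) :
    Subtype.val ((sUnitsToTruncD K S).hom.hom w) =
      (ideleData K).toSystem.of E (haveI := E.numberField
        Additive.ofMul (IdeleHerbrand.truncOf S (IdeleHerbrand.principal E.1 a))) := by
  haveI := E.numberField
  rw [sUnitsToTruncD_hom_apply, coe_sUnitsToTruncAddHom_apply, ← coe_sUnitsToUnitsKS_apply, ← ha,
    GalLayerData.Hom.limitMap_of, truncBar_of]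
  rfl

/-! ## §4. `I_S → C̄_S` -/

variable (K S) in
/-- **`I_S → C̄_S` in `C_{G_S}`** (`I_S ↪ J_{K_S} → C_{K_S} ↠ C̄_S`; the second map of Harari's (17.1)).
[cite: Harari2020, §17.4 (17.1), Def. 15.38] -/
def truncToClassBarSD : truncIdeleBarD K S ⟶ classBarSD K S :=
  ObjectProperty.homMk (truncIdeleBarToClassKS K S ≫ toClassBarS K S)

/-- Formula on vectors. [cite: Harari2020, §17.4 (17.1)] -/
theorem truncToClassBarSD_hom_apply (z : (truncIdeleBarD K S).obj.V) :
    (truncToClassBarSD K S).hom.hom z =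
      (toClassBarS K S).hom ((idelesToClassKS K S).hom ((inclKS K S).hom z)) := rfl

/-- **On a layer: `I_S → C̄_S` sends `[x]_E` (`x ∈ J_E` with `[x]_E ∈ I_S`, `E ⊂ K_S`) to `ofLayerS [x]`**, the class of
`x` in `C_E` read in `C̄_S`. [cite: Harari2020, §17.4 (17.1), Def. 15.38] -/
theorem truncToClassBarSD_of {E : GalLayer K}
    (hE : ramificationSubgroup K (↑S : Set (HeightOneSpectrum (𝓞 K))) ≤ galFixing K E.1)
    (x : (ideleData K).V E) (hx : (ideleData K).toSystem.of E x ∈ truncIdeleBar K S) :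
    (truncToClassBarSD K S).hom.hom ⟨(ideleData K).toSystem.of E x, hx⟩ = ofLayerS S hE ((ideleToClass K).app E x) := by
  rw [truncToClassBarSD_hom_apply, toClassBarS_hom_apply, ofLayerS_apply]
  refine congrArg (Submodule.Quotient.mk (p := unitsOffKS K S)) (Subtype.ext ?_)
  rw [coe_idelesToClassKS_apply, coe_toKS]
  change (ideleToClass K).limitMap ((ideleData K).toSystem.of E x) = _
  rw [GalLayerData.Hom.limitMap_of]
  rfl

/-! ## §5. `S`-units and truncated principal idèles; the short complex (17.1) -/

section Layer

variable {E : Type} [Field E] [NumberField E] [Algebra K E]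

/-- **`(a) ∈ J_{E,S}^{Tate}` (units off `S`) iff `a` is an `S`-unit** (Harari: `J_{F,S} ∩ (F^* U_{F,S}) = i(𝒪_{F,S}^*)`,
valuation criterion). [cite: Harari2020, Lemma 15.39 (proof)] [cite: NeukirchSchmidtWingberg2008, VIII §3] -/
theorem principal_mem_ideleS_iff_mem_sUnits' (a : Eˣ) :
    IdeleHerbrand.principal E a ∈ ideleS K E S ↔ a ∈ sUnits K (↑S : Set (HeightOneSpectrum (𝓞 K))) E := by
  rw [mem_ideleS_iff, mem_sUnits_iff_forall_valuation_eq_one]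
  refine forall_congr' fun w => ?_
  rw [valued_principal_snd, Finset.mem_coe]

/-- **For an `S`-unit `a`: `(a) · ((a)^{(S)})⁻¹ ∈ U_{E,S}`** (units off `S`, `1` on `S ∪ ∞`). [cite: Harari2020, Lemma 15.39 (proof)] -/
theorem principal_mul_truncOf_inv_mem_unitIdelesOff {a : Eˣ} (ha : a ∈ sUnits K (↑S : Set (HeightOneSpectrum (𝓞 K))) E) :
    IdeleHerbrand.principal E a * (IdeleHerbrand.truncOf S (IdeleHerbrand.principal E a))⁻¹ ∈
      IdeleHerbrand.unitIdelesOff K E S :=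
  IdeleHerbrand.mul_truncOf_inv_mem_unitIdelesOff S ((principal_mem_ideleS_iff_mem_sUnits' a).2 ha)

/-- **The class of `(a)^{(S)}` in `C_E` is the class of an element of `U_{E,S}`** (namely of `((a)·((a)^{(S)})⁻¹)⁻¹`), for an
`S`-unit `a`. [cite: Harari2020, Lemma 15.39 (proof)] -/
theorem mk_truncOf_principal_mem_range_unitsOffToClass {a : Eˣ} (ha : a ∈ sUnits K (↑S : Set (HeightOneSpectrum (𝓞 K))) E) :
    (Additive.ofMul ((IdeleHerbrand.truncOf S (IdeleHerbrand.principal E a) : ideleGroup E) : IdeleClassGroup E) :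
        (IdeleClassGroup.galoisRep K E).V) ∈ (unitsOffToClass (F := K) (E := E) S).hom.range := by
  refine ⟨Additive.ofMul ⟨(IdeleHerbrand.principal E a * (IdeleHerbrand.truncOf S (IdeleHerbrand.principal E a))⁻¹)⁻¹,
    (IdeleHerbrand.unitIdelesOff K E S).inv_mem (principal_mul_truncOf_inv_mem_unitIdelesOff ha)⟩, ?_⟩
  change Additive.ofMul (((IdeleHerbrand.principal E a *
      (IdeleHerbrand.truncOf S (IdeleHerbrand.principal E a))⁻¹)⁻¹ : ideleGroup E) : IdeleClassGroup E) = _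
  refine congrArg Additive.ofMul ?_
  rw [QuotientGroup.eq]
  refine ⟨a, ?_⟩
  rw [inv_inv, inv_mul_cancel_right]
  rfl

end Layer

/-- **`E_S → I_S → C̄_S` is zero**: for `[a]_E ∈ E_S` the class of `(a)^{(S)}` is that of an element of `U_{E,S}`, which
dies in `C̄_S = C_{K_S} ⧸ Ū_S`. [cite: Harari2020, §17.4 (17.1), Lemma 15.39 (proof)] -/
theorem truncToClassBarSD_sUnitsToTruncD_apply (w : (sUnitsKSD K S).obj.V) :
    (truncToClassBarSD K S).hom.hom ((sUnitsToTruncD K S).hom.hom w) = 0 := by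
  obtain ⟨E, hE, a, ha, hw⟩ := exists_layer_sUnit w
  haveI := E.numberField
  have hE' : ramificationSubgroup K (↑S : Set (HeightOneSpectrum (𝓞 K))) ≤ galFixing K E.1 := by
    rw [galFixing_eq_coe_openNormalSubgroup]; exact hE
  have hval := coe_sUnitsToTruncD_of (w := w) a hw
  have hmem : (ideleData K).toSystem.of E
      (Additive.ofMul (IdeleHerbrand.truncOf S (IdeleHerbrand.principal E.1 a))) ∈ truncIdeleBar K S := by
    rw [← hval]; exact ((sUnitsToTruncD K S).hom.hom w).2
  have heq : (sUnitsToTruncD K S).hom.hom w =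
      ⟨(ideleData K).toSystem.of E (Additive.ofMul (IdeleHerbrand.truncOf S (IdeleHerbrand.principal E.1 a))), hmem⟩ :=
    Subtype.ext hval
  rw [heq, truncToClassBarSD_of hE']
  exact ofLayerS_eq_zero_of_mem_range S hE' (mk_truncOf_principal_mem_range_unitsOffToClass (K := K) (S := S) ha)

/-- **`(E_S → I_S) ≫ (I_S → C̄_S) = 0` in `C_{G_S}`.** [cite: Harari2020, §17.4 (17.1)] -/
theorem sUnitsToTruncD_comp_truncToClassBarSD : sUnitsToTruncD K S ≫ truncToClassBarSD K S = 0 := by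
  apply ObjectProperty.hom_ext
  apply Rep.hom_ext
  refine DFunLike.ext _ _ fun w => ?_
  exact truncToClassBarSD_sUnitsToTruncD_apply w

variable (K S) in
/-- **Harari's (17.1) `E_S → I_S → C̄_S` as a short complex in `C_{G_S} = DiscreteRepCat ℤ G_S`.**
[cite: Harari2020, §17.4 (17.1)] [cite: NeukirchSchmidtWingberg2008, VIII §3] -/
def truncSeqS : ShortComplex (DiscreteRepCat ℤ (GaloisGroupUnramifiedOutside K (↑S : Set (HeightOneSpectrum (𝓞 K))))) :=
  ShortComplex.mk (sUnitsToTruncD K S) (truncToClassBarSD K S) sUnitsToTruncD_comp_truncToClassBarSD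

/-- `X₁ = E_S`. [cite: Harari2020, §17.4 (17.1)] -/
theorem truncSeqS_X₁ : (truncSeqS K S).X₁ = sUnitsKSD K S := rfl

/-- `X₂ = I_S`. [cite: Harari2020, §17.4 (17.1)] -/
theorem truncSeqS_X₂ : (truncSeqS K S).X₂ = truncIdeleBarD K S := rfl

/-- `X₃ = C̄_S`. [cite: Harari2020, §17.4 (17.1)] -/
theorem truncSeqS_X₃ : (truncSeqS K S).X₃ = classBarSD K S := rfl

/-- `f = (E_S → I_S)`. [cite: Harari2020, §17.4 (17.1)] -/
theorem truncSeqS_f : (truncSeqS K S).f = sUnitsToTruncD K S := rfl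

/-- `g = (I_S → C̄_S)`. [cite: Harari2020, §17.4 (17.1)] -/
theorem truncSeqS_g : (truncSeqS K S).g = truncToClassBarSD K S := rfl

/-- **`E_S → I_S` is a monomorphism in `C_{G_S}`** (left exactness of (17.1)). [cite: Harari2020, Lemma 15.39, §17.4 (17.1)] -/
theorem mono_truncSeqS_f : Mono (truncSeqS K S).f :=
  (DiscreteRep.ι ℤ (GaloisGroupUnramifiedOutside K (↑S : Set (HeightOneSpectrum (𝓞 K))))).mono_of_mono_map
    ((Rep.mono_iff_injective (sUnitsToTruncD K S).hom).2 sUnitsToTruncD_injective)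

end IdeleClassBar

end Literature.NumberTheory.GaloisRepresentations

end
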